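import Summits.BirchSwinnertonDyer.BirchSwinnertonDyer.Theorems.KolyvaginDepthDoorDepthTableRowKitNoTwist
import Summits.BirchSwinnertonDyer.BirchSwinnertonDyer.Theorems.KolyvaginDepthDoorKolyvaginDepthSupplyDoorNoTwistTwistSelmer
import HarnessLib

/-!
# Route `KolyvaginDepthDoor` — the DEPTH-TABLE ROW KIT, twist-free, OTHER EIGENSPACE: the order of
# `Sel_p(E^{(D)}/ℚ)` from the bit (crux `KolyvaginDepthSupply`, stmt-BirchSwinnertonDyer-21765)

Helper file (`--supports stmt-BirchSwinnertonDyer-21765 --as helper`); it closes nothing and BSD is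
not proved by it.

Companion of `depthRow_noTwist_of_print_of_intModel_certificate` (file `…DepthTableRowKitNoTwist`):
same inputs (integer model, `2 ≤ rank`, the odd prime `p` with its surjectivity tower, the Heegner
field with `d_K = D`, the Kolyvagin prime `ℓ`, a compatible system of Kolyvagin–Heegner data, the five
named McCallum facts, the bit `(d ℓ).kolyvaginClass hp 1 ≠ 0`; NO twist point), conclusion on the
TWIST: `#Sel^(p)(E^{(D)}/ℚ) ≤ p` and the descent count
`p^{rank E^{(D)}(ℚ)} · #E^{(D)}(ℚ)[p] · #Ш(E^{(D)}/ℚ)[p] ≤ p` — Kolyvagin's second eigen-bound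
`#Sel(E/K)_p^- ≤ p` read over `ℚ` through `Sel_p(E^{(D)}/ℚ) ↪ Sel_p(E/K)^-` (Literature
`SelmerTorsionTwistRestriction`, PROVED; door `…DoorNoTwistTwistSelmer`). This is the hF-free,
twist-point-free counterpart of the hF-rows' `corank Sel_{p^∞}(E^{(D)}/ℚ) = 1`.

* `depthRow_noTwist_twistSelmer_of_print_of_intModel_certificate`.

CONDITIONAL on the five named facts, the compatible system and the bit; per-curve; BSD is not proved
by it. References: [Kolyvagin1991MathAnn] Thm. 2.3; [GrossLMS1991] §5 (5.1); [McCallumLMS1991] §§2–5;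
[WZhang2014] Notations (xii); [JetchevLauterStein2009] §3.6.
-/

set_option linter.dupNamespace false

noncomputable section

open scoped Classical NumberField

namespace Summit.BirchSwinnertonDyer.BirchSwinnertonDyer.Theorems.KolyvaginDepthDoor

open Literature.NumberTheory.EllipticCurves Literature.NumberTheory.EllipticCurves.ModularForms
  Literature.NumberTheory.EllipticCurves.McCallum1991 WeierstrassCurve NumberField IsDedekindDomain

section Generic

variable {W : WeierstrassCurve ℚ} [W.IsElliptic] [W.IsGloballyMinimal] {E₀ : WeierstrassCurve ℤ}
  (hI : integralModelInt W = E₀)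
include hI

/-- **The order of `Sel_p(E^{(D)}/ℚ)` from a depth-table row, off an integer model, no `hF`, no twist
point.** Inputs VERBATIM those of `depthRow_noTwist_of_print_of_intModel_certificate`; OUTPUT from the
bit `(d ℓ).kolyvaginClass hp 1 ≠ 0`: `#Sel^(p)(E^{(D)}/ℚ) ≤ p` and
`p^{rank_ℤ E^{(D)}(ℚ)} · #E^{(D)}(ℚ)[p] · #Ш(E^{(D)}/ℚ)[p] ≤ p`
(`natCard_selmerGroup_twist_le_of_kolyvaginClass_prime_ne_zero_of_print`, file
`…DoorNoTwistTwistSelmer`, with the row kit's `isKolyvaginPrime_of_intModel_certificate` and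
`satisfiesHeegnerHypothesis_conductorNorm_of_intModel`). CONDITIONAL on the five facts; per-curve;
BSD is not proved by it. [cite: Kolyvagin1991MathAnn, Thm. 2.3] [cite: McCallumLMS1991, §§2–5]
[cite: GrossLMS1991, §5 (5.1)] [cite: WZhang2014, Notations (xii)]
[cite: JetchevLauterStein2009, §3.6 (arXiv:0707.0032)] -/
theorem depthRow_noTwist_twistSelmer_of_print_of_intModel_certificate
    (h54 : sign_conjAct_kolyvaginClass) (h43 : lemma43_kolyvaginClass_mem_selmerLocalKer)
    (h44 : prop44_localOrder_kolyvaginClass_mul_eq) (h53 : lemma53_selmer_eigen_dependent_at)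
    (h22 : prop22_reciprocity_eigen_finset)
    (hcm : ¬ W.HasCM) (hr : 2 ≤ W.mordellWeilRank)
    (p : ℕ) [hp : Fact p.Prime] (hp2 : p ≠ 2)
    (htower : ∀ n : ℕ, W.HasSurjectiveModNGaloisRep (p ^ n : ℕ))
    (K : Type) [Field K] [NumberField K] (hK : IsImaginaryQuadratic K) {D : ℤ}
    (hD : NumberField.discr K = D) (h3 : D ≠ -3) (h4 : D ≠ -4)
    (hH : ∀ q : ℕ, q.Prime → (q : ℤ) ∣ E₀.Δ → (q = 2 → D % 8 = 1) ∧ (q ≠ 2 → jacobiSym D q = 1))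
    (ℓ : ℕ) (hℓ : ℓ.Prime) (hℓ2 : ℓ ≠ 2) (hℓΔ : ¬ (ℓ : ℤ) ∣ E₀.Δ) (hℓD : ¬ (ℓ : ℤ) ∣ D)
    (hℓp : ℓ ≠ p) (hjac : jacobiSym D ℓ = -1) (hℓ1 : p ∣ ℓ + 1) {n : ℕ}
    (hcard : Nat.card ((E₀.map (Int.castRingHom (ZMod ℓ))).toAffine.Point) = n)
    (haℓ : (p : ℤ) ∣ (ℓ : ℤ) + 1 - n)
    [NeZero (W.conductorNorm ℤ)] (Dt : ModularParametrizationData W (W.conductorNorm ℤ)) (β : ℤ)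
    (ι : K →+* ℂ) (d : ∀ m : ℕ, KolyvaginHeegnerData Dt β ι m)
    (hσ : ∀ (m l : ℕ), ∀ l' ∈ m.primeFactors, ∀ (x : ringClassField K ι m)
      (x' : ringClassField K ι (m * l)),
      (x : ℂ) = x' → (((d (m * l)).σ l' x' : ringClassField K ι (m * l)) : ℂ) = ((d m).σ l' x : ℂ))
    (hS₁ : ∀ (m l : ℕ), ∀ s ∈ (d m).S, ∃ s' ∈ (d (m * l)).S, ∀ (x : ringClassField K ι m)
      (x' : ringClassField K ι (m * l)),
      (x : ℂ) = x' → ((s' x' : ringClassField K ι (m * l)) : ℂ) = (s x : ℂ))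
    (hS₂ : ∀ (m l : ℕ), ∀ s' ∈ (d (m * l)).S, ∃ s ∈ (d m).S, ∀ (x : ringClassField K ι m)
      (x' : ringClassField K ι (m * l)),
      (x : ℂ) = x' → ((s' x' : ringClassField K ι (m * l)) : ℂ) = (s x : ℂ))
    (hemb : ∀ (m l : ℕ) (x : ringClassField K ι m) (x' : ringClassField K ι (m * l)),
      (x : ℂ) = x' → (d (m * l)).emb x' = (d m).emb x)
    (hne : (d ℓ).kolyvaginClass hp.out 1 ≠ 0) :
    Nat.card ↥(selmerGroup (W.quadraticTwist (D : ℚ)) (p : ℤ)) ≤ p ∧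
      p ^ (W.quadraticTwist (D : ℚ)).mordellWeilRank *
          Nat.card ↥(AddSubgroup.torsionBy (W.quadraticTwist (D : ℚ)).toAffine.Point (p : ℤ)) *
          Nat.card ↥((W.quadraticTwist (D : ℚ)).sha ⊓
            AddSubgroup.torsionBy (W.quadraticTwist (D : ℚ)).galH1 (p : ℤ)) ≤ p := by
  obtain ⟨hkol, -⟩ := isKolyvaginPrime_of_intModel_certificate hI p K hK.1 hD ℓ hℓ hℓ2 hℓΔ hℓD
    hℓp hjac hℓ1 hcard haℓ
  obtain ⟨c, hc, hcc⟩ := exists_conj_of_isImaginaryQuadratic K hK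
  have hH' := satisfiesHeegnerHypothesis_conductorNorm_of_intModel hI K hK.1 hD hH
  obtain ⟨-, hSel, hcount⟩ :=
    natCard_selmerGroup_twist_le_of_kolyvaginClass_prime_ne_zero_of_print h54 h43 h44 h53 h22 hcm hK
      (by rw [hD]; exact h3) (by rw [hD]; exact h4) hH' p hp2 htower c hc hcc d hσ hS₁ hS₂ hemb hkol
      hne hr
  rw [pow_one] at hSel hcount
  rw [hD] at hSel hcount
  exact ⟨hSel, hcount⟩

end Generic

end Summit.BirchSwinnertonDyer.BirchSwinnertonDyer.Theorems.KolyvaginDepthDoor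

end
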